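import Literature.NumberTheory.Rogawski1990.ArchSingularMembersPinRatioRational   -- ★ p844084 (W4g): `smul_one_of_coe_coe_cmRationalToArch_eq_smul_one` (+ ★ (W4f) shapes, ★ top-form family)
import HarnessLib

/-!
# (b2)+(b3) THE CLASS-LEVEL JUNCTION: the (J-val-K-built) export of ★ (W4f) gives `mGis c = K • TF c` at every archimedean class stably conjugate to a non-central singular
# rational `γ₀ ⊗ 1` — the `hK` binder of ★ (W6′) `tamagawaSingularKappaBlock_transport_of_eq_smul` (Rogawski 1990 §1.7; §3.8 Prop. 3.8.1 (a); §14.5 Lemma 14.5.2 (b))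

Topic `NumberTheory/Rogawski1990`; namespace `Literature.NumberTheory.Rogawski1990`.  THEOREMS ONLY (no `def`, no instance, no notation, no axiom, no named fact, no `sorry`).
Cell `pub/hodgecm-mathlib`, ENGINE T1 (crux H413 = `stmt-HodgeConjecture-24833`); the `stub_S1` road, bricks (b2)+(b3) of CENSUS (W7) 420dda0c (F0P3a-p07 (g10); LEAD F0P3a-plan
(g10) WORD T9-32 (2)).  Count-neutral; HONEST LABEL: HC_CM is proved only modulo the printed citations until rung 0 closes.

WHAT.  ★ (W4f) `exists_archSingularMembers_withData_of_universal_pinRatio` exports, for the BUILT archimedean singular member `mGis` (an ★ `IsQuotientOf` family of `ν′` by the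
torus datum `TsG` on the guard «`x` corresponds to a non-regular rational `γ₀`»), the pin (J-val-K-built) «guard ∧ ¬(`x` scalar `σ(ζ)•1`) ∧ framed ⟹ `TsG x = K⁻¹ • centralizerTopFormHaar L H′ x`».
The differential-top-form family `TF := UnitaryArchTopForm.archSingularTopFormFamily L H′ ν′` is, at framed classes, the Weil quotient of the SAME `ν′` by `centralizerTopFormHaar`
(★ `archSingularTopFormFamily_apply`).  Hence at every class `c` whose representative is stably conjugate to `γ₀ ⊗ 1` with `γ₀` non-regular and NON-CENTRAL (§1: then `out c` is
not scalar — (b3), stable conjugacy to a non-scalar) and FRAMED (hypothesis `hframe` = brick (b5), F0P3-p03 (g11)): `mGis c = dν′∕d(K⁻¹ • cTFH) = K • dν′∕d(cTFH) = K • TF c`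
(★ `quotientMeasure_eq_inv_smul_of_eq_smul`) — the CLASS-LEVEL proportionality ★ (W6′) consumes (§2).  Everything is Mathlib + ★; no new definition.

* §1 `not_exists_coe_eq_mixedEmbedding_smul_one_of_corresponds` — (b3): a point of `U(H′)(L⁺ ⊗ ℝ)` stably conjugate to `γ₀ ⊗ 1`, `γ₀` non-central, is not a scalar `σ(ζ)•1`.
* §2 **`eq_smul_archSingularTopFormFamily_of_pinRatio`** — (b2): the `hK` binder of ★ (W6′) for `(mGis, TF)` from (W4f)'s `IsQuotientOf` + (J-val-K-built) + frames (b5).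

## References
* [Rogawski1990] J. D. Rogawski, *Automorphic Representations of Unitary Groups in Three Variables*, Ann. of Math. Stud. 123 (1990), §1.7 p. 6; §3.1 p. 19; §3.8 Prop. 3.8.1 (a) p. 27;
  §14.5 Lemma 14.5.2 (b) pp. 238–239.
* [DeitmarEchterhoff2014] A. Deitmar, S. Echterhoff, *Principles of Harmonic Analysis*, 2nd ed. (2014), Thm. 1.5.3.
-/

set_option autoImplicit false

noncomputable section

open MeasureTheory Measure NumberField NumberField.InfinitePlace NumberField.mixedEmbedding
open Literature.MeasureTheory.Group Literature.NumberTheory.Automorphic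
open Literature.NumberTheory.Automorphic.UnitaryGroup hiding hermForm
open Literature.NumberTheory.Weil1964 Literature.NumberTheory.Weil1964.UnitaryArchTopForm
open Literature.AlgebraicGeometry.ShimuraVarieties (unitaryGroup hermForm)
open scoped Matrix MatrixGroups NNReal ENNReal

namespace Literature.NumberTheory.Rogawski1990

variable (L : Type) [Field L] [NumberField L] [IsCMField L] (H' : Matrix (Fin 3) (Fin 3) L)

/-! ## §1 (b3) Stable conjugates of a non-central rational point are not scalar -/

/-- **(b3)** If `x ∈ U(H′)(L⁺ ⊗ ℝ)` corresponds (is `GL₃(L ⊗ ℝ)`-conjugate) to `γ₀ ⊗ 1` and `γ₀ ∈ U(H′)(L)` is NOT a scalar `ζ•1`, then `x` is not a scalar `σ(ζ)•1`: a conjugate of a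
scalar is that scalar, and `γ₀ ⊗ 1 = σ(ζ)•1` forces `γ₀ = ζ•1` (★ `smul_one_of_coe_coe_cmRationalToArch_eq_smul_one`). [cite: Rogawski1990, §3.1 p. 19; §14.1 p. 232] -/
theorem not_exists_coe_eq_mixedEmbedding_smul_one_of_corresponds (γ₀ : (UnitaryGroup.cmDatum L 3 H').Rational)
    (hncen : ¬ ∃ ζ : L, (((γ₀ : unitaryGroup (cmConjRingHom L) H').val : GL (Fin 3) L) : Matrix (Fin 3) (Fin 3) L) = ζ • (1 : Matrix (Fin 3) (Fin 3) L))
    (x : arch (↥(maximalRealSubfield L)) L (IsCMField.complexConj L) 3 H')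
    (hx : Corresponds (conjMixed (↥(maximalRealSubfield L)) L (IsCMField.complexConj L)) (archFormOf L 3 H') (archFormOf L 3 H') (cmRationalToArch L 3 H' γ₀) x) :
    ¬ ∃ ζ : L, ((x : GL (Fin 3) (mixedSpace L)) : Matrix (Fin 3) (Fin 3) (mixedSpace L)) = mixedEmbedding L ζ • (1 : Matrix (Fin 3) (Fin 3) (mixedSpace L)) := by
  rintro ⟨ζ, hζ⟩
  obtain ⟨g, hg⟩ := isConj_iff.mp hx
  -- `γ₀ ⊗ 1 = g⁻¹ x g = σ(ζ)•1`
  have h0 : (((cmRationalToArch L 3 H' γ₀ : arch (↥(maximalRealSubfield L)) L (IsCMField.complexConj L) 3 H') : GL (Fin 3) (mixedSpace L)) : Matrix (Fin 3) (Fin 3) (mixedSpace L)) =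
      mixedEmbedding L ζ • (1 : Matrix (Fin 3) (Fin 3) (mixedSpace L)) := by
    have h1 : ((cmRationalToArch L 3 H' γ₀ : arch (↥(maximalRealSubfield L)) L (IsCMField.complexConj L) 3 H') : GL (Fin 3) (mixedSpace L)) =
        g⁻¹ * (x : GL (Fin 3) (mixedSpace L)) * g := by
      rw [← hg]; group
    have h2 := congrArg (fun u : GL (Fin 3) (mixedSpace L) => (u : Matrix (Fin 3) (Fin 3) (mixedSpace L))) h1
    simp only [Units.val_mul] at h2
    rw [h2, hζ, Matrix.mul_smul, Matrix.mul_one, Matrix.smul_mul, ← Units.val_mul, inv_mul_cancel, Units.val_one]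
  exact hncen ⟨ζ, smul_one_of_coe_coe_cmRationalToArch_eq_smul_one L H' γ₀ h0⟩

/-! ## §2 (b2) The class-level proportionality from the (J-val-K-built) pin -/

variable
    [MeasurableSpace (arch (↥(maximalRealSubfield L)) L (IsCMField.complexConj L) 3 H')] [BorelSpace (arch (↥(maximalRealSubfield L)) L (IsCMField.complexConj L) 3 H')]
    [∀ γ : arch (↥(maximalRealSubfield L)) L (IsCMField.complexConj L) 3 H',
      MeasurableSpace (arch (↥(maximalRealSubfield L)) L (IsCMField.complexConj L) 3 H' ⧸ Subgroup.centralizer ({γ} : Set (arch (↥(maximalRealSubfield L)) L (IsCMField.complexConj L) 3 H')))]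
    [∀ γ : arch (↥(maximalRealSubfield L)) L (IsCMField.complexConj L) 3 H',
      BorelSpace (arch (↥(maximalRealSubfield L)) L (IsCMField.complexConj L) 3 H' ⧸ Subgroup.centralizer ({γ} : Set (arch (↥(maximalRealSubfield L)) L (IsCMField.complexConj L) 3 H')))]
    (ν' : Measure (arch (↥(maximalRealSubfield L)) L (IsCMField.complexConj L) 3 H')) [ν'.IsHaarMeasure] [ν'.IsMulRightInvariant]

/-- **(b2) THE CLASS-LEVEL JUNCTION.**  For an archimedean family `mGis` in Weil form `hQ : mGis.IsQuotientOf guard ν′ TsG` (guard = «corresponds to a non-regular rational `γ₀`»; ★ (W4f)'s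
first conjunct) whose torus datum satisfies the (J-val-K-built) pin `hJ` of ★ (W4f) VERBATIM («guard ∧ not scalar ∧ framed ⟹ `TsG x = K⁻¹ • centralizerTopFormHaar L H′ x`»), and frames
at every guard point off the centre (`hframe`, brick (b5)): at every class `c` of `U(H′)(L⁺ ⊗ ℝ)` whose representative corresponds to a non-regular NON-CENTRAL rational `γ₀`,
`mGis c = K • archSingularTopFormFamily L H′ ν′ c` — the `hK` binder of ★ (W6′) `tamagawaSingularKappaBlock_transport_of_eq_smul` for `(m₁, m₂) := (mGis, TF)`.  Both members are
Weil quotients of the same `ν′` at `out c` (★ `IsQuotientOf`, ★ `archSingularTopFormFamily_apply`), by `TsG (out c) = K⁻¹ • cTFH (out c)` and ★ `quotientMeasure_eq_inv_smul_of_eq_smul`.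
[cite: Rogawski1990, §1.7 p. 6; §3.8 Prop. 3.8.1 (a) p. 27; §14.5 Lemma 14.5.2 (b) pp. 238–239] [cite: DeitmarEchterhoff2014, Thm. 1.5.3] -/
theorem eq_smul_archSingularTopFormFamily_of_pinRatio
    {mGis : OrbitalMeasureFamily (arch (↥(maximalRealSubfield L)) L (IsCMField.complexConj L) 3 H')}
    {TsG : ∀ γ : arch (↥(maximalRealSubfield L)) L (IsCMField.complexConj L) 3 H', Measure ↥(Subgroup.centralizer ({γ} : Set (arch (↥(maximalRealSubfield L)) L (IsCMField.complexConj L) 3 H')))}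
    (hQ : mGis.IsQuotientOf (fun x : arch (↥(maximalRealSubfield L)) L (IsCMField.complexConj L) 3 H' => ∃ γ₀ : (cmDatum L 3 H').Rational, ¬ IsRegularElt (γ₀.val : GL (Fin 3) L) ∧
        Corresponds (conjMixed (↥(maximalRealSubfield L)) L (IsCMField.complexConj L)) (archFormOf L 3 H') (archFormOf L 3 H') (cmRationalToArch L 3 H' γ₀) x) ν' TsG)
    (K : ℝ≥0) (hK0 : K ≠ 0)
    (hJ : ∀ x : arch (↥(maximalRealSubfield L)) L (IsCMField.complexConj L) 3 H', (∃ γ₀ : (cmDatum L 3 H').Rational, ¬ IsRegularElt (γ₀.val : GL (Fin 3) L) ∧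
          Corresponds (conjMixed (↥(maximalRealSubfield L)) L (IsCMField.complexConj L)) (archFormOf L 3 H') (archFormOf L 3 H') (cmRationalToArch L 3 H' γ₀) x) →
        (¬ ∃ ζ : L, ((x : GL (Fin 3) (mixedSpace L)) : Matrix (Fin 3) (Fin 3) (mixedSpace L)) = mixedEmbedding L ζ • (1 : Matrix (Fin 3) (Fin 3) (mixedSpace L))) →
        (∃ (a b : L) (Tm : GL (Fin 3) (mixedSpace L)) (H_a : Matrix (Fin 2) (Fin 2) L) (H_b : Matrix (Fin 1) (Fin 1) L), IsSingularArchFrame L H' x a b Tm H_a H_b) →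
        TsG x = K⁻¹ • centralizerTopFormHaar L H' x)
    (hframe : ∀ x : arch (↥(maximalRealSubfield L)) L (IsCMField.complexConj L) 3 H', (∃ γ₀ : (cmDatum L 3 H').Rational, ¬ IsRegularElt (γ₀.val : GL (Fin 3) L) ∧
          Corresponds (conjMixed (↥(maximalRealSubfield L)) L (IsCMField.complexConj L)) (archFormOf L 3 H') (archFormOf L 3 H') (cmRationalToArch L 3 H' γ₀) x) →
        (¬ ∃ ζ : L, ((x : GL (Fin 3) (mixedSpace L)) : Matrix (Fin 3) (Fin 3) (mixedSpace L)) = mixedEmbedding L ζ • (1 : Matrix (Fin 3) (Fin 3) (mixedSpace L))) →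
        ∃ (a b : L) (Tm : GL (Fin 3) (mixedSpace L)) (H_a : Matrix (Fin 2) (Fin 2) L) (H_b : Matrix (Fin 1) (Fin 1) L), IsSingularArchFrame L H' x a b Tm H_a H_b) :
    ∀ c : ConjClasses (arch (↥(maximalRealSubfield L)) L (IsCMField.complexConj L) 3 H'),
      (∃ γ₀ : (cmDatum L 3 H').Rational, ¬ IsRegularElt (γ₀.val : GL (Fin 3) L) ∧
        (¬ ∃ ζ : L, ((γ₀.val : GL (Fin 3) L) : Matrix (Fin 3) (Fin 3) L) = ζ • (1 : Matrix (Fin 3) (Fin 3) L)) ∧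
        Corresponds (conjMixed (↥(maximalRealSubfield L)) L (IsCMField.complexConj L)) (archFormOf L 3 H') (archFormOf L 3 H') (cmRationalToArch L 3 H' γ₀) (Quotient.out c)) →
      mGis c = K • archSingularTopFormFamily L H' ν' c := by
  rintro c ⟨γ₀, hnreg, hncen, hst⟩
  have hguard : ∃ γ₀ : (cmDatum L 3 H').Rational, ¬ IsRegularElt (γ₀.val : GL (Fin 3) L) ∧
      Corresponds (conjMixed (↥(maximalRealSubfield L)) L (IsCMField.complexConj L)) (archFormOf L 3 H') (archFormOf L 3 H') (cmRationalToArch L 3 H' γ₀) (Quotient.out c) :=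
    ⟨γ₀, hnreg, hst⟩
  have hnsc := not_exists_coe_eq_mixedEmbedding_smul_one_of_corresponds L H' γ₀ hncen (Quotient.out c) hst
  have hfr := hframe (Quotient.out c) hguard hnsc
  have hpin := hJ (Quotient.out c) hguard hnsc hfr
  obtain ⟨hT, hTi, hm⟩ := hQ c hguard
  haveI := hT; haveI := hTi
  haveI := isHaarMeasure_centralizerTopFormHaar hfr.choose_spec.choose_spec.choose_spec.choose_spec.choose_spec
  haveI := isInvInvariant_centralizerTopFormHaar hfr.choose_spec.choose_spec.choose_spec.choose_spec.choose_spec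
  haveI hZc : IsClosed ((Subgroup.centralizer ({(Quotient.out c : arch (↥(maximalRealSubfield L)) L (IsCMField.complexConj L) 3 H')} :
      Set (arch (↥(maximalRealSubfield L)) L (IsCMField.complexConj L) 3 H')) : Subgroup _) : Set (arch (↥(maximalRealSubfield L)) L (IsCMField.complexConj L) 3 H')) :=
    isClosed_coe_centralizer_singleton (Quotient.out c)
  haveI : LocallyCompactSpace (Subgroup.centralizer ({(Quotient.out c : arch (↥(maximalRealSubfield L)) L (IsCMField.complexConj L) 3 H')} :
      Set (arch (↥(maximalRealSubfield L)) L (IsCMField.complexConj L) 3 H'))) := hZc.isClosedEmbedding_subtypeVal.locallyCompactSpace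
  haveI : SecondCountableTopology (Subgroup.centralizer ({(Quotient.out c : arch (↥(maximalRealSubfield L)) L (IsCMField.complexConj L) 3 H')} :
      Set (arch (↥(maximalRealSubfield L)) L (IsCMField.complexConj L) 3 H'))) := TopologicalSpace.Subtype.secondCountableTopology _
  rw [archSingularTopFormFamily_apply, dif_pos hfr, hm,
    quotientMeasure_eq_inv_smul_of_eq_smul (hH := isClosed_coe_centralizer_singleton (Quotient.out c))
      (Subgroup.centralizer ({(Quotient.out c : arch (↥(maximalRealSubfield L)) L (IsCMField.complexConj L) 3 H')} : Set (arch (↥(maximalRealSubfield L)) L (IsCMField.complexConj L) 3 H')))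
      ν' (centralizerTopFormHaar L H' (Quotient.out c)) (TsG (Quotient.out c)) K⁻¹ (inv_ne_zero hK0) hpin,
    inv_inv]

end Literature.NumberTheory.Rogawski1990

end
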